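import Summits.QuantumFields.BalabanUV.Beta.FP.GhostMixCubicTwoLeg
import Summits.QuantumFields.BalabanUV.Beta.FP.BondFamilyCovariance

/-!
# `Beta/FP/GhostMixPieceCubic` — road «FP» (binder row D1), row KER-γ (α2) sub-row **α2-c** «GHOST», PART 2b(ii): THE (MIX-3) GHOST PIECE OF THE JUNCTION — the
# windowed `(c, e)`-table of the cubic word (direction-`c` averaging jet at `s`, inner leg back to the root block, scalar two-point leg `Γ` from the jet's field point,
# direction-`e` background jet `Ḣ` of the scalar covariant Laplacian at the bond `(s′, e)`) as a DATA def, its joint `N`-block periodicity under DISPLAYED covariance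
# letters, its majorant, entry bound and LEDGER LINE by name over F′'s `FineSplitJunctionMajorant.rem_of_majorant` (p253277)

HONEST DEPENDENCY (page 1, mandatory): continuum YM on T⁴ ⇐ BetaPertH ∧ nine spine estimates (0/9 proved); BetaPertH ⇐ (D1) ∧ (D4) ∧
CAP+tail; G-an2-4 gates asym, D1 and NE2/3/4.  HONEST FRAMING (cell contract, verbatim): «discharging `BetaPertH` makes Bałaban's UV
stability UNCONDITIONAL — a real constructive-QFT result; it is NOT the continuum limit and NOT the Clay problem.»  THIS MODULE is [our object] bookkeeping (one
data def over ABSTRACT constituents — bond-letter family `(p, rad)`, coarse windows `U`, offsets `W`, inner leg `I`, legs `Γ`, `Ḣ` — every road letter DISPLAYED: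
(radCov)(Ucov)(Icov)(Γcov)(Hcov), (W), (I₀), (Γ₀)(Γ₁), (H)(H0), the vertex-mass sup letter (Msup), the junction's (Kcov)(col)(J)(J′)) and [folklore] plumbing BY NAME
over `MixLoopPowerCountingMassCubic.abs_mix3_le_mass` ∕ `windowedMajorant_mix3_le`, `GhostMixTwoLeg.windowedMass_bond_le` (p253304), `BondFamilyCovariance.ker₁_bond_shift`
(PART 2 helper) and F′.  It asserts nothing about Bałaban's constrained objects, cites nothing, mints no `Prop` fact, 0 sorry.  NOT (H2), NOT the instances of `Γ`∕`Ḣ`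
((LEDGER-gh)), NOT hsplit, NOT D1, NOT BetaPertH, NOT continuum, NOT Clay.

ABSOLUTE RULE (cell charter, verbatim): «No internally-minted statement may enter as a cited fact. Every hypothesis is either kernel-proved in this
package or a verbatim quotation of a PUBLISHED theorem with page reference. The manuscript(s) under audit are NOT citable for their own disputed
steps — they are the thing under adjudication; programme-internal (2001/route/tribunal) claims are never citable.»

CONTENT: §1 [our object] **`gmix3Piece`** + `gmix3Piece_apply`; §2 [folklore] **`isBlockPeriodic_gmix3Piece`**; §3 [folklore] **`kappa_gmix3Piece`**, **`profile_le_consts`**,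
**`bounded_gmix3Piece`**; §4 [folklore] **`ledger_gmix3Piece`**.
Provenance: D1 formalisation swarm LEAF PROVER 05, unit `b2b-balaban-beta-d1-formalise-leaf-05` gen 15, 2026-08-21, road FP row KER-γ (α2) sub-row α2-c (owner GO
R-FP-35 (a), words l.28227 «PART 2 THIS SHAPE», l.28436, l.28614; R-FP-36 (b)); «not in print; our bookkeeping»; no existing file touched.
-/

noncomputable section

namespace Summit.QuantumFields.BalabanUV.Beta.FP.GhostMixPieceCubic

open Finset Real
open scoped BigOperators
open Literature.MathematicalPhysics.QuantumFieldTheory.Balaban1983to89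
open Literature.MathematicalPhysics.QuantumFieldTheory.Balaban1983to89.Beta
open B12Sec2to5 (l1)
open ExpKernelCalculus (Site MKer shiftK Zl Zl_pos)
open OneStepResolventKernel (Fib)
open OneStepKernelFamily (colH)
open DyadicShell (Pt supNorm)
open AxialBlockWeights (fineBlock)
open Summit.QuantumFields.BalabanUV.Beta.D1BFx.MomentTransferPeriodic (IsBlockPeriodic)
open Summit.QuantumFields.BalabanUV.Beta.D1BFx.MomentTransferPeriodicEntry (EKer₂ dressedEntryP)
open Summit.QuantumFields.BalabanUV.Beta.FP.TransportInfinityM (colOf)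
open Summit.QuantumFields.BalabanUV.Beta.FP.AveragingJetLettersRooted (ker₁)
open Summit.QuantumFields.BalabanUV.Beta.FP.ScalarAveragingJetLetters (sclW sclFld sclBg)
open Summit.QuantumFields.BalabanUV.Beta.FP.MixLoopPowerCounting (supNorm_cast_nonneg)
open Summit.QuantumFields.BalabanUV.Beta.FP.MixLoopPowerCountingMassCubic (abs_mix3_le_mass windowedMajorant_mix3_le)
open Summit.QuantumFields.BalabanUV.Beta.FP.GhostMixTwoLeg (windowedMass_bond_le)
open Summit.QuantumFields.BalabanUV.Beta.FP.FineSplitJunctionMajorant (rem_of_majorant)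
open Summit.QuantumFields.BalabanUV.Beta.FP.BondFamilyCovariance (ker₁_bond_shift)

variable {σ : Type*} [Fintype σ]

/-! ## §1 The windowed (MIX-3) ghost piece -/

/-- [our object] **THE WINDOWED (MIX-3) GHOST PIECE** of the junction's near table: the `(c, e)` entry at `(s, s′)` is the cubic word — the direction-`c` averaging jet of
the bond-letter 0-form family at `s`, the inner leg `I` from the coarse root `u` to a fine point `x′`, the scalar two-point leg `Γ` from the jet's field point `s + w` to
`x`, and the direction-`e` background jet `Ḣ e s′ x x′` at the bond `(s′, e)` — summed over `U s`, `W` and the fine points, CUT OFF at `‖s′ − s‖∞ ≤ Nw`. -/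
def gmix3Piece (N : ℕ) (p : σ → ℝ) (rad : σ → Pt → Pt → List (Pt × Fin 4)) (U : Pt → Finset Pt) (W : Finset Pt)
    (I Γ : Pt → Pt → ℝ) (H : Fin 4 → Pt → Pt → Pt → ℝ) (Nw : ℕ) : EKer₂ 4 :=
  fun c e s s' => if supNorm (s' - s) ≤ Nw then
    ∑ u ∈ U s, ∑ w ∈ W, ker₁ (sclW N p) (sclFld N u) (sclBg N u rad) (s, c) (s + w) *
      ∑' x', I x' u * ∑' x, Γ (s + w) x * H e s' x x' else 0

/-- [our object] the piece, unfolded. -/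
theorem gmix3Piece_apply (N : ℕ) (p : σ → ℝ) (rad : σ → Pt → Pt → List (Pt × Fin 4)) (U : Pt → Finset Pt) (W : Finset Pt)
    (I Γ : Pt → Pt → ℝ) (H : Fin 4 → Pt → Pt → Pt → ℝ) (Nw : ℕ) (c e : Fin 4) (s s' : Pt) :
    gmix3Piece N p rad U W I Γ H Nw c e s s' = if supNorm (s' - s) ≤ Nw then
      ∑ u ∈ U s, ∑ w ∈ W, ker₁ (sclW N p) (sclFld N u) (sclBg N u rad) (s, c) (s + w) *
        ∑' x', I x' u * ∑' x, Γ (s + w) x * H e s' x x' else 0 := rfl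

/-! ## §2 The joint block periodicity of the piece -/

section Periodicity

variable {N : ℕ} {p : σ → ℝ} {rad : σ → Pt → Pt → List (Pt × Fin 4)}

/-- [folklore] **THE (MIX-3) GHOST PIECE IS JOINTLY `N`-BLOCK PERIODIC** (F′'s `hGper`) under (radCov), (Ucov), (Icov) `I (x′ + N•t) (u + t) = I x′ u`, (Γcov)
`Γ (x + N•t) (y + N•t) = Γ x y` and (Hcov) `Ḣ e (b′ + N•t) (x + N•t) (x′ + N•t) = Ḣ e b′ x x′` (the fine sums are re-indexed by the translation). -/
theorem isBlockPeriodic_gmix3Piece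
    (hradCov : ∀ (s : σ) (u t x' : Pt), rad s (u + t) x' = (rad s u x').map (fun ℓ => (ℓ.1 + (N : ℤ) • t, ℓ.2)))
    {U : Pt → Finset Pt} (hUcov : ∀ b t : Pt, U (b + (N : ℤ) • t) = (U b).image (· + t))
    {I : Pt → Pt → ℝ} (hIcov : ∀ x u t : Pt, I (x + (N : ℤ) • t) (u + t) = I x u)
    {Γ : Pt → Pt → ℝ} (hΓcov : ∀ x y t : Pt, Γ (x + (N : ℤ) • t) (y + (N : ℤ) • t) = Γ x y)
    {H : Fin 4 → Pt → Pt → Pt → ℝ} (hHcov : ∀ (e : Fin 4) (b' x x' t : Pt), H e (b' + (N : ℤ) • t) (x + (N : ℤ) • t) (x' + (N : ℤ) • t) = H e b' x x')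
    (W : Finset Pt) (Nw : ℕ) (c e : Fin 4) :
    IsBlockPeriodic N (gmix3Piece N p rad U W I Γ H Nw c e) := by
  classical
  intro t s s'
  simp only [gmix3Piece_apply]
  have ew : supNorm (s' + (N : ℤ) • t - (s + (N : ℤ) • t)) = supNorm (s' - s) := by rw [add_sub_add_right_eq_sub]
  rw [ew, hUcov s t, Finset.sum_image fun x _ y _ h => add_left_injective t h]
  refine if_congr Iff.rfl (Finset.sum_congr rfl fun u _ => Finset.sum_congr rfl fun w _ => ?_) rfl
  have e1 : s + (N : ℤ) • t + w = s + w + (N : ℤ) • t := add_right_comm _ _ _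
  rw [e1, ker₁_bond_shift hradCov]
  congr 1
  rw [← (Equiv.addRight ((N : ℤ) • t)).tsum_eq]
  refine tsum_congr fun x' => ?_
  simp only [Equiv.coe_addRight]
  rw [hIcov, ← (Equiv.addRight ((N : ℤ) • t)).tsum_eq]
  refine congrArg _ (tsum_congr fun x => ?_)
  simp only [Equiv.coe_addRight]
  rw [hΓcov, hHcov]

end Periodicity

/-! ## §3 The majorant and the entry bound -/

section Shape

variable {N : ℕ} {p : σ → ℝ} {rad : σ → Pt → Pt → List (Pt × Fin 4)} {U : Pt → Finset Pt} {W : Finset Pt}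
  {I Γ : Pt → Pt → ℝ} {H : Fin 4 → Pt → Pt → Pt → ℝ} {C_I C_Γ C_Γ' C_H δ δH : ℝ}

/-- [folklore] **THE MAJORANT OF THE (MIX-3) GHOST PIECE** (F′'s (hk): `MixLoopPowerCountingMassCubic.abs_mix3_le_mass` BY NAME at `Ḣ := Ḣ e`; the cut-off only helps):
under (I₀) `|I x′ u| ≤ C_I`, (Γ₀)(Γ₁) at rate `δ∕N`, (H)(H0) per direction. -/
theorem kappa_gmix3Piece (hδ : 0 < δ) (hδH : 0 < δH) (hN : 1 ≤ N) (hI0 : ∀ x' u, |I x' u| ≤ C_I) (hΓ0 : ∀ c x, |Γ c x| ≤ C_Γ)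
    (hΓ1 : ∀ c t (i : Fin 4), |Γ c (t + Pi.single i 1) - Γ c t|
      ≤ C_Γ' / ((supNorm (c - t) : ℝ) + 1) ^ 3 * Real.exp (-(δ / N) * (supNorm (c - t) : ℝ)))
    (hH : ∀ e b' x x', |H e b' x x'| ≤ C_H * Real.exp (-δH * l1 (x - b')) * Real.exp (-δH * l1 (x' - b')))
    (hH0 : ∀ e b' x', ∑' x, H e b' x x' = 0) (Nw : ℕ) (c e : Fin 4) (s s' : Pt) :
    |gmix3Piece N p rad U W I Γ H Nw c e s s'|
      ≤ ∑ u ∈ U s, ∑ w ∈ W, |ker₁ (sclW N p) (sclFld N u) (sclBg N u rad) (s, c) (s + w)| * (C_I * (C_H * Zl 4 δH) *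
        ((256 / 27 * C_Γ' * (Real.exp (δH / 2) * (2 / δH) * Zl 4 (δH / 2)))
            * (Real.exp (-(3 * δ / 4 / N) * (supNorm (s + w - s') : ℝ)) / ((supNorm (s + w - s') : ℝ) + 1) ^ 3)
          + (2 * C_Γ * 20 ^ 8 * (40320 * Real.exp (δH / 2) * (2 / δH) ^ 8 * Zl 4 (δH / 2))
              + (8 * C_Γ * (Real.exp (δH / 2) * (2 / δH) * Zl 4 (δH / 2)) + 2 * C_Γ * (Real.exp (δH / 2) * Zl 4 (δH / 2))) * 5 ^ 8)
            / ((supNorm (s + w - s') : ℝ) + 1) ^ 8)) := by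
  have hmain := abs_mix3_le_mass (U := U) (W := W) (qd := fun u b x => ker₁ (sclW N p) (sclFld N u) (sclBg N u rad) (b, c) x)
    (I := I) (Γ := Γ) (H := H e) hδ hδH hN hI0 hΓ0 hΓ1 (hH e) (hH0 e) s s'
  rw [gmix3Piece_apply]
  split_ifs
  · exact hmain
  · rw [abs_zero]
    exact le_trans (abs_nonneg _) hmain

/-- [folklore] the cubic profile is at most the sum of its constants: `K₁·e^{−…}∕(r+1)³ + K₂∕(r+1)⁸ ≤ K₁ + K₂` (`K₁, K₂ ≥ 0`, `r ≥ 0`). -/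
theorem profile_le_consts {K₁ K₂ r a : ℝ} (hK₁ : 0 ≤ K₁) (hK₂ : 0 ≤ K₂) (hr : 0 ≤ r) (ha : 0 ≤ a) :
    K₁ * (Real.exp (-a) / (r + 1) ^ 3) + K₂ / (r + 1) ^ 8 ≤ K₁ + K₂ := by
  have h1 : (1 : ℝ) ≤ (r + 1) ^ 3 := one_le_pow₀ (by linarith)
  have h2 : (1 : ℝ) ≤ (r + 1) ^ 8 := one_le_pow₀ (by linarith)
  have he : Real.exp (-a) ≤ 1 := Real.exp_le_one_iff.mpr (by linarith)
  have hA : Real.exp (-a) / (r + 1) ^ 3 ≤ 1 := by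
    rw [div_le_one (by positivity)]; exact he.trans h1
  have hB : K₂ / (r + 1) ^ 8 ≤ K₂ := div_le_self hK₂ h2
  nlinarith [mul_le_mul_of_nonneg_left hA hK₁]

/-- [folklore] **ENTRY BOUND** (F′'s `hGb`): with the vertex-mass sup letter (Msup) `Σ_{u∈U s}Σ_w|ker₁^{(u)}(s,c)(s+w)| ≤ Msup`, every entry is bounded by
`Msup·(C_I·(C_H·Zl 4 δ_H))·(K₁ + K₂)`. -/
theorem bounded_gmix3Piece (hδ : 0 < δ) (hδH : 0 < δH) (hN : 1 ≤ N) (hI0 : ∀ x' u, |I x' u| ≤ C_I) (hΓ0 : ∀ c x, |Γ c x| ≤ C_Γ)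
    (hΓ1 : ∀ c t (i : Fin 4), |Γ c (t + Pi.single i 1) - Γ c t|
      ≤ C_Γ' / ((supNorm (c - t) : ℝ) + 1) ^ 3 * Real.exp (-(δ / N) * (supNorm (c - t) : ℝ)))
    (hH : ∀ e b' x x', |H e b' x x'| ≤ C_H * Real.exp (-δH * l1 (x - b')) * Real.exp (-δH * l1 (x' - b')))
    (hH0 : ∀ e b' x', ∑' x, H e b' x x' = 0)
    {Msup : ℝ} (hMsup : ∀ (c : Fin 4) (s : Pt), ∑ u ∈ U s, ∑ w ∈ W, |ker₁ (sclW N p) (sclFld N u) (sclBg N u rad) (s, c) (s + w)| ≤ Msup)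
    (Nw : ℕ) (c e : Fin 4) :
    ∃ A, ∀ s s', |gmix3Piece N p rad U W I Γ H Nw c e s s'| ≤ A := by
  -- nonnegativity of the cubic constants (as in `coarse_mix3_secondMoment_le`)
  have hCI : 0 ≤ C_I := (abs_nonneg _).trans (hI0 0 0)
  have hCΓ : 0 ≤ C_Γ := (abs_nonneg _).trans (hΓ0 0 0)
  have hCΓ' : 0 ≤ C_Γ' := by
    have h := hΓ1 0 0 0
    rw [sub_self, show supNorm (0 : Pt) = 0 from DyadicShell.supNorm_eq_zero_iff.mpr rfl] at h
    norm_num at h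
    exact (abs_nonneg _).trans h
  have hCH : 0 ≤ C_H := by
    have h := hH 0 0 0 0
    rw [sub_self, show l1 (0 : Pt) = 0 by unfold l1; simp, mul_zero, Real.exp_zero, mul_one, mul_one] at h
    exact (abs_nonneg _).trans h
  have hZ : 0 < Zl 4 δH := Zl_pos hδH
  have hZ2 : 0 < Zl 4 (δH / 2) := Zl_pos (half_pos hδH)
  set K₁ : ℝ := 256 / 27 * C_Γ' * (Real.exp (δH / 2) * (2 / δH) * Zl 4 (δH / 2)) with hK₁def
  set K₂ : ℝ := 2 * C_Γ * 20 ^ 8 * (40320 * Real.exp (δH / 2) * (2 / δH) ^ 8 * Zl 4 (δH / 2))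
      + (8 * C_Γ * (Real.exp (δH / 2) * (2 / δH) * Zl 4 (δH / 2)) + 2 * C_Γ * (Real.exp (δH / 2) * Zl 4 (δH / 2))) * 5 ^ 8 with hK₂def
  set L : ℝ := C_I * (C_H * Zl 4 δH) with hLdef
  have hK₁ : 0 ≤ K₁ := by positivity
  have hK₂ : 0 ≤ K₂ := by positivity
  have hL : 0 ≤ L := by positivity
  have h0 : ∀ (c : Fin 4) (s : Pt), 0 ≤ ∑ u ∈ U s, ∑ w ∈ W, |ker₁ (sclW N p) (sclFld N u) (sclBg N u rad) (s, c) (s + w)| :=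
    fun c s => Finset.sum_nonneg fun _ _ => Finset.sum_nonneg fun _ _ => abs_nonneg _
  have hMsup0 : 0 ≤ Msup := (h0 c 0).trans (hMsup c 0)
  refine ⟨Msup * (L * (K₁ + K₂)), fun s s' => ?_⟩
  have hN' : (0 : ℝ) < N := by exact_mod_cast hN
  -- termwise: the profile is at most `K₁ + K₂`
  have hterm : ∀ u w, |ker₁ (sclW N p) (sclFld N u) (sclBg N u rad) (s, c) (s + w)| * (L *
      (K₁ * (Real.exp (-(3 * δ / 4 / N) * (supNorm (s + w - s') : ℝ)) / ((supNorm (s + w - s') : ℝ) + 1) ^ 3)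
        + K₂ / ((supNorm (s + w - s') : ℝ) + 1) ^ 8))
      ≤ |ker₁ (sclW N p) (sclFld N u) (sclBg N u rad) (s, c) (s + w)| * (L * (K₁ + K₂)) := by
    intro u w
    refine mul_le_mul_of_nonneg_left (mul_le_mul_of_nonneg_left ?_ hL) (abs_nonneg _)
    have hr : (0 : ℝ) ≤ (supNorm (s + w - s') : ℝ) := supNorm_cast_nonneg _
    have ha : 0 ≤ 3 * δ / 4 / N * (supNorm (s + w - s') : ℝ) := by positivity
    have h := profile_le_consts (K₁ := K₁) (K₂ := K₂) hK₁ hK₂ hr ha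
    have e : -(3 * δ / 4 / (N : ℝ)) * (supNorm (s + w - s') : ℝ) = -(3 * δ / 4 / (N : ℝ) * (supNorm (s + w - s') : ℝ)) := by ring
    rw [e]
    exact h
  calc |gmix3Piece N p rad U W I Γ H Nw c e s s'|
      ≤ _ := kappa_gmix3Piece hδ hδH hN hI0 hΓ0 hΓ1 hH hH0 Nw c e s s'
    _ ≤ ∑ u ∈ U s, ∑ w ∈ W, |ker₁ (sclW N p) (sclFld N u) (sclBg N u rad) (s, c) (s + w)| * (L * (K₁ + K₂)) :=
        Finset.sum_le_sum fun u _ => Finset.sum_le_sum fun w _ => hterm u w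
    _ = (∑ u ∈ U s, ∑ w ∈ W, |ker₁ (sclW N p) (sclFld N u) (sclBg N u rad) (s, c) (s + w)|) * (L * (K₁ + K₂)) := by
        rw [Finset.sum_mul]; exact Finset.sum_congr rfl fun u _ => by rw [Finset.sum_mul]
    _ ≤ Msup * (L * (K₁ + K₂)) := mul_le_mul_of_nonneg_right (hMsup c s) (by positivity)

end Shape

/-! ## §4 The ledger line, by name over `FineSplitJunctionMajorant.rem_of_majorant` -/

section Ledger

variable {N : ℕ} {p : σ → ℝ} {rad : σ → Pt → Pt → List (Pt × Fin 4)} {ℓ₀ R₀ : ℕ} {U : Pt → Finset Pt} {W : Finset Pt}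
  {I Γ : Pt → Pt → ℝ} {H : Fin 4 → Pt → Pt → Pt → ℝ} {C_I C_Γ C_Γ' C_H δ δH C_J C_J' : ℝ} {K : MKer (3 + 1) (Fib 3)} {a b : Fin 4}

/-- **THE LEDGER LINE OF THE (MIX-3) GHOST PIECE** [folklore] (the `hLgh` binder for this piece): `K` block-covariant with absolutely summable END columns and the
column letters (J) (anchor `0`) ∕ (J′) at the window rate `δ`; the bond family's letters (`p ≥ 0`, length `≤ ℓ₀`, radius `R₀N`, (radCov)); (Ucov); (W) at `R₀+1`; the
legs' letters (I₀)(Icov), (Γ₀)(Γ₁)(Γcov), (H)(H0)(Hcov); the vertex-mass sup letter (Msup) ⟹ for every finite coarse `S′`,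
`Σ_{u∈S′}‖u‖∞²·|dressedEntryP (colH K N · 0 ·) (gmix3Piece N p rad U W I Γ Ḣ Nw) (N•(−u)) a b| ≤ 16·(3·C_J·C_J′·(1+16∕δ²)·((C_I·(C_H·Zl 4 δ_H))·Ψ·A_M))` with the cubic
engine's `Ψ` (explicit `N¹`) at radius multiplier `R₀+1` and `A_M = (ℓ₀Σp)e^{δR₀∕2}(e^{δ∕2}(1+480e^{δ∕4}(4∕δ)⁴))` (`rem_of_majorant`; (Mκ) at the anchor `0` :=
`windowedMajorant_mix3_le` with (M) := `windowedMass_bond_le` BY NAME). -/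
theorem ledger_gmix3Piece (hδ : 0 < δ) (hδH : 0 < δH) (hN : 1 ≤ N)
    (hKcov : ∀ t : Fin (3 + 1) → ℤ, shiftK (-((N : ℤ) • t)) K = K)
    (hcol : ∀ κ l : Fin 4, Summable fun x => |colOf K κ l x|)
    (hp : ∀ s, 0 ≤ p s) (hrad : ∀ s u x', (rad s u x').length ≤ ℓ₀)
    (hradR : ∀ (s : σ) (u : Pt) (x : ↥(fineBlock N)) (ℓ : Pt × Fin 4), ℓ ∈ rad s u x.1 → supNorm (ℓ.1 - (N : ℤ) • u) ≤ R₀ * N)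
    (hradCov : ∀ (s : σ) (u t x' : Pt), rad s (u + t) x' = (rad s u x').map (fun ℓ => (ℓ.1 + (N : ℤ) • t, ℓ.2)))
    (hUcov : ∀ b t : Pt, U (b + (N : ℤ) • t) = (U b).image (· + t))
    (hW : ∀ w ∈ W, supNorm w ≤ (R₀ + 1) * N)
    (hI0 : ∀ x' u, |I x' u| ≤ C_I) (hIcov : ∀ x u t : Pt, I (x + (N : ℤ) • t) (u + t) = I x u)
    (hΓ0 : ∀ c x, |Γ c x| ≤ C_Γ)
    (hΓ1 : ∀ c t (i : Fin 4), |Γ c (t + Pi.single i 1) - Γ c t|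
      ≤ C_Γ' / ((supNorm (c - t) : ℝ) + 1) ^ 3 * Real.exp (-(δ / N) * (supNorm (c - t) : ℝ)))
    (hΓcov : ∀ x y t : Pt, Γ (x + (N : ℤ) • t) (y + (N : ℤ) • t) = Γ x y)
    (hH : ∀ e b' x x', |H e b' x x'| ≤ C_H * Real.exp (-δH * l1 (x - b')) * Real.exp (-δH * l1 (x' - b')))
    (hH0 : ∀ e b' x', ∑' x, H e b' x x' = 0)
    (hHcov : ∀ (e : Fin 4) (b' x x' t : Pt), H e (b' + (N : ℤ) • t) (x + (N : ℤ) • t) (x' + (N : ℤ) • t) = H e b' x x')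
    {Msup : ℝ} (hMsup : ∀ (c : Fin 4) (s : Pt), ∑ u ∈ U s, ∑ w ∈ W, |ker₁ (sclW N p) (sclFld N u) (sclBg N u rad) (s, c) (s + w)| ≤ Msup)
    (hJ : ∀ (c : Fin 4) (q : Pt), |colH K N a 0 c q| ≤ C_J * Real.exp (-(δ / N) * (supNorm (q - (N : ℤ) • (0 : Pt)) : ℝ)))
    (hJ' : ∀ (e : Fin 4) (S' : Finset Pt) (x : Pt), ∑ u ∈ S', (1 + ((supNorm (x - (N : ℤ) • u) : ℝ) / N) ^ 2) * |colH K N b u e x| ≤ C_J')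
    (Nw : ℕ) :
    ∀ S' : Finset Pt, ∑ u ∈ S', (supNorm u : ℝ) ^ 2 *
        |dressedEntryP (fun c a' => colH K N a' 0 c) (gmix3Piece N p rad U W I Γ H Nw) ((N : ℤ) • (-u)) a b|
      ≤ 16 * (3 * C_J * C_J' * (1 + 16 / δ ^ 2) *
          ((C_I * (C_H * Zl 4 δH)) *
            ((256 / 27 * C_Γ' * (Real.exp (δH / 2) * (2 / δH) * Zl 4 (δH / 2)))
                * ((1 + 2 * ((R₀ : ℝ) + 1) ^ 2) * (1 + 80 * Real.exp ((3 * δ / 4) / 2) * (2 / (3 * δ / 4)))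
                  + 2 * (1 + 160 * Real.exp ((3 * δ / 4) / 2) * (2 / (3 * δ / 4)) ^ 3)) * N
              + (2 * C_Γ * 20 ^ 8 * (40320 * Real.exp (δH / 2) * (2 / δH) ^ 8 * Zl 4 (δH / 2))
                  + (8 * C_Γ * (Real.exp (δH / 2) * (2 / δH) * Zl 4 (δH / 2)) + 2 * C_Γ * (Real.exp (δH / 2) * Zl 4 (δH / 2))) * 5 ^ 8)
                * 81 * (3 + 2 * ((R₀ : ℝ) + 1) ^ 2)) *
            ((((ℓ₀ : ℕ) : ℝ) * ∑ s, p s) * Real.exp (δ * R₀ / 2) *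
              (Real.exp (δ / 2) * (1 + 480 * Real.exp (δ / 4) * (4 / δ) ^ 4))))) := by
  -- nonnegativity of the cubic constants
  have hCI : 0 ≤ C_I := (abs_nonneg _).trans (hI0 0 0)
  have hCΓ : 0 ≤ C_Γ := (abs_nonneg _).trans (hΓ0 0 0)
  have hCΓ' : 0 ≤ C_Γ' := by
    have h := hΓ1 0 0 0
    rw [sub_self, show supNorm (0 : Pt) = 0 from DyadicShell.supNorm_eq_zero_iff.mpr rfl] at h
    norm_num at h
    exact (abs_nonneg _).trans h
  have hCH : 0 ≤ C_H := by
    have h := hH 0 0 0 0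
    rw [sub_self, show l1 (0 : Pt) = 0 by unfold l1; simp, mul_zero, Real.exp_zero, mul_one, mul_one] at h
    exact (abs_nonneg _).trans h
  have hZ : 0 < Zl 4 δH := Zl_pos hδH
  have hZ2 : 0 < Zl 4 (δH / 2) := Zl_pos (half_pos hδH)
  have hK₁ : 0 ≤ 256 / 27 * C_Γ' * (Real.exp (δH / 2) * (2 / δH) * Zl 4 (δH / 2)) := by positivity
  have hK₂ : 0 ≤ 2 * C_Γ * 20 ^ 8 * (40320 * Real.exp (δH / 2) * (2 / δH) ^ 8 * Zl 4 (δH / 2))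
      + (8 * C_Γ * (Real.exp (δH / 2) * (2 / δH) * Zl 4 (δH / 2)) + 2 * C_Γ * (Real.exp (δH / 2) * Zl 4 (δH / 2))) * 5 ^ 8 := by
    positivity
  have hL : 0 ≤ C_I * (C_H * Zl 4 δH) := by positivity
  -- (Mκ) at the anchor `0`
  have hAκ : ∀ (c e : Fin 4) (A : Finset Pt),
      ∑ q ∈ A, ∑ x ∈ A, Real.exp (-(δ / (2 * N)) * (supNorm (q - (N : ℤ) • (0 : Pt)) : ℝ)) * (1 + ((supNorm (x - q) : ℝ) / N) ^ 2) *
        (∑ u ∈ U q, ∑ w ∈ W, |ker₁ (sclW N p) (sclFld N u) (sclBg N u rad) (q, c) (q + w)| * (C_I * (C_H * Zl 4 δH) *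
          ((256 / 27 * C_Γ' * (Real.exp (δH / 2) * (2 / δH) * Zl 4 (δH / 2)))
              * (Real.exp (-(3 * δ / 4 / N) * (supNorm (q + w - x) : ℝ)) / ((supNorm (q + w - x) : ℝ) + 1) ^ 3)
            + (2 * C_Γ * 20 ^ 8 * (40320 * Real.exp (δH / 2) * (2 / δH) ^ 8 * Zl 4 (δH / 2))
                + (8 * C_Γ * (Real.exp (δH / 2) * (2 / δH) * Zl 4 (δH / 2)) + 2 * C_Γ * (Real.exp (δH / 2) * Zl 4 (δH / 2))) * 5 ^ 8)
              / ((supNorm (q + w - x) : ℝ) + 1) ^ 8)))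
        ≤ (C_I * (C_H * Zl 4 δH)) *
            ((256 / 27 * C_Γ' * (Real.exp (δH / 2) * (2 / δH) * Zl 4 (δH / 2)))
                * ((1 + 2 * ((R₀ : ℝ) + 1) ^ 2) * (1 + 80 * Real.exp ((3 * δ / 4) / 2) * (2 / (3 * δ / 4)))
                  + 2 * (1 + 160 * Real.exp ((3 * δ / 4) / 2) * (2 / (3 * δ / 4)) ^ 3)) * N
              + (2 * C_Γ * 20 ^ 8 * (40320 * Real.exp (δH / 2) * (2 / δH) ^ 8 * Zl 4 (δH / 2))
                  + (8 * C_Γ * (Real.exp (δH / 2) * (2 / δH) * Zl 4 (δH / 2)) + 2 * C_Γ * (Real.exp (δH / 2) * Zl 4 (δH / 2))) * 5 ^ 8)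
                * 81 * (3 + 2 * ((R₀ : ℝ) + 1) ^ 2)) *
            ((((ℓ₀ : ℕ) : ℝ) * ∑ s, p s) * Real.exp (δ * R₀ / 2) *
              (Real.exp (δ / 2) * (1 + 480 * Real.exp (δ / 4) * (4 / δ) ^ 4))) := by
    intro c e A
    have hM := windowedMass_bond_le hδ hN hp hrad hradR U W A c ((N : ℤ) • (0 : Pt))
    have hmaj := windowedMajorant_mix3_le (qd := fun u b x => ker₁ (sclW N p) (sclFld N u) (sclBg N u rad) (b, c) x)
      (U := U) (W := W) (n := N) (R := R₀ + 1) hδ hN hK₁ hK₂ hL hW A (0 : Pt) hM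
    have e1 : (((R₀ + 1 : ℕ) : ℝ)) = (R₀ : ℝ) + 1 := by push_cast; ring
    rw [e1] at hmaj
    exact hmaj
  exact rem_of_majorant (G := gmix3Piece N p rad U W I Γ H Nw) hδ hN hKcov hcol
    (fun c e => isBlockPeriodic_gmix3Piece hradCov hUcov hIcov hΓcov hHcov W Nw c e)
    (fun c e => bounded_gmix3Piece hδ hδH hN hI0 hΓ0 hΓ1 hH hH0 hMsup Nw c e)
    (fun c e s s' => kappa_gmix3Piece hδ hδH hN hI0 hΓ0 hΓ1 hH hH0 Nw c e s s') hAκ hJ hJ'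

end Ledger

end Summit.QuantumFields.BalabanUV.Beta.FP.GhostMixPieceCubic

end
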